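import Summits.ValiantsHypothesis.ValiantsHypothesis.Theorems.DefinabilityGapRatioLeaf
import HarnessLib

/-!
# DefinabilityGap — the constant skeleton: `G_m` hits every FULL width-2 read-once chain that does not stall

Route `route-ValiantsHypothesis-DefinabilityGap` (decomp-valiant cycle 1, lens 5), read-once leaf F4 / W10
(`KIPlantedHittingRO`, stmt-ValiantsHypothesis-23704), width road. `P_c = kiPer m c`, `φ = bind₁ (kiPer m)`,
`ψ_c = axisHom m c i₀` (the pattern-axis substitution of `DefinabilityGapAxisSubstitution`: `ψ_c(P_c) = X`,
`ψ_c(P_{c'}) = 0` for `c' ≠ c` when `m ≥ 3`, `ψ_c(φ E) = E(0)` for `E` not reading `z_c`).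

A width-2 read-once block chain is `D = uᵀ · M_1(z_{c_1}) ⋯ M_N(z_{c_N}) · v` (`chainVal`, links `W2Link`, distinct
blocks, ANY order, ANY length, ARBITRARY univariate `2 × 2` links). Its CONSTANT SKELETON is the list of constant-term
matrices `M_j(0)` (`constMat`); the skeleton vectors are `M_{k+1}(0) ⋯ M_N(0) · v` (`skel` of the suffixes).

RESULTS (kernel, `m ≥ 3`):
* `col_parallel` — **DIRECTION RIGIDITY**: if every link is nonsingular (`det M_j ≠ 0` in `ℂ[X]`), no proper-suffix
  skeleton vector vanishes, and the `φ`-image of the column vector `G = M_1(z_1)⋯M_N(z_N)·v` has a CONSTANT direction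
  `w ∈ ℂ²` (`φ(G_k) = x · w_k`), then `G` itself has that constant direction: `G_k = X(z) · w_k` in `ℂ[z]`;
* `chainVal_eq_zero_of_skel` — **HITTING**: under the same two hypotheses `φ(D) = 0 ⟹ D = 0` (apply rigidity to the
  direction `w = (u_1, -u_0) ⊥ u` forced by `uᵀ φ(G) = 0`);
* `kiPer_hits_of_det_constMat_ne_zero` — in particular EVERY width-2 read-once chain whose constant-term matrices `M_j(0)`
  are all INVERTIBLE is hit (any `u, v`, order, length, degree); `kiPer_hits_matrixProduct_of_constantCoeff` — the same
  in the matrix-product currency of `IsROABP` (entries `aeval (X (π i)) p`, `π` injective, every entry of the product).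
The class decided here contains the `m = 2` COUNTEREXAMPLE (`DefinabilityGapWidthTwoAtTwo`: the 4-cycle unipotent chain
`(1,0)·∏[[1, ±z_b],[0,1]]·(0,1)ᵀ`, all `M_j(0)` unipotent, hence invertible): that mechanism (and every
`[SahaSaptharishiSaxena2009, L2.1]`-type unipotent linear-form chain) cannot recur at any `m ≥ 3`, and `m ≥ 3` is SHARP.

PROOF (the step, `step`): peel the head link `M = M_1`, `c = c_1`, `Φ_j = φ(G'_j)` the suffix columns, `g = ` the suffix
skeleton vector `= (Φ_j)(0)`. From `M(P_c)·Φ = x·w`: (b) applying `ψ_c` gives `M(X)·g = ψ_c(x)·w` in `ℂ[X]²` EXACTLY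
(`ψ_c ∘ φ` freezes the other blocks at `0`); (a) the two adjugate identities `det M(P_c)·Φ = x·adj M(P_c)·w` and (from (b),
pushed forward along `X ↦ P_c`) `det M(P_c)·g = ξ·adj M(P_c)·w` give `det M(P_c)²·(Φ_0 g_1 − Φ_1 g_0) = 0`, and
`det M(P_c) ≠ 0` (`P_c` transcendental, `aeval_kiPer_ne_zero`): `Φ ∥ g`, a CONSTANT direction again because `g ≠ 0`
— induct; on the way back `M(z_c)·g = ψ_c(x)(z_c)·w` reassembles the column. No unique factorisation, no valuations,
no chart: the NW-design is used only through `ψ_c` (two blocks share `≤ 2 < m` cells).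

PLACEMENT / HONEST GRADE: helper of stmt-23704; rung 0 of its width ladder; 0 S-currency; `K1`, `K2c`, `b ≥ 2`,
`KIAnnihilatorDefinableOnCollapse`, VP ≠ VNP untouched. It carries the substitution step of (B) of
`DefinabilityGapAxisSubstitution` from unit-TRIANGULAR links to FULL NONSINGULAR links ((B) also admits singular triangular
links `p_j = 0`, so neither statement contains the other) and types the census remark «full width 2 stalls exactly when
`M₂(0)⋯M_N(0)` kills the propagated vector» as a theorem: the one-sided NO-STALL class is hit. WHAT REMAINS of full
width 2 at `m ≥ 3`
(= `RatioLeaf(m)`, `DefinabilityGapRatioLeaf.ratioLeaf_iff`): chains with a SINGULAR link (they factor through a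
`RatioLeaf` configuration) and nonsingular chains whose skeleton STALLS (`M_{k+1}(0)⋯M_N(0)·v = 0` for some cut `k`;
by transposition also `uᵀM_1(0)⋯M_{k'}(0) = 0` for some `k'` — the mirror statement is not typed here). The census
sub-cell «`RatioLeaf(3)` at suffix length `≤ 2`» is not touched by this file: a suffix of length `≤ 2` plus the head
block reads `|T| ≤ 3` blocks, `2(|T| - 1) < m²`, which are algebraically independent
(`DefinabilityGapSupportRung.kiPer_algebraicIndependent`, `kiPer_hits_support`), so that sub-cell carries no width-2
content; the width-2 content starts at chains reading more than `m²/2 + 1` blocks.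
[cite: SahaSaptharishiSaxena2009, Lemma 2.1] [cite: KabanetsImpagliazzo2003, Lemma 30]
-/

noncomputable section

open MvPolynomial
open scoped Polynomial
open Literature.Computability.AlgebraicComplexity Literature.Computability.MetaComplexity

namespace Summit.ValiantsHypothesis.ValiantsHypothesis.Theorems.DefinabilityGapRegularSkeleton

open Summit.ValiantsHypothesis.ValiantsHypothesis.Theorems.DefinabilityGapAffineRung
open Summit.ValiantsHypothesis.ValiantsHypothesis.Theorems.DefinabilityGapAxisSubstitution
open Summit.ValiantsHypothesis.ValiantsHypothesis.Theorems.DefinabilityGapZperTransfer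
open Summit.ValiantsHypothesis.ValiantsHypothesis.Theorems.DefinabilityGapRatioLeaf

variable {m : ℕ}

/-! ## 1. Columns of a chain and its constant skeleton -/

/-- The column value `G_k = (M_1(z_1) ⋯ M_N(z_N) · v)_k = chainVal l e_k v`. [this file] -/
def col (l : List (W2Link m)) (v : Fin 2 → ℂ) (k : Fin 2) : MvPolynomial (Fin 3 → Fin (qOf m)) ℂ :=
  chainVal (l.map W2Link.mat) (Pi.single k 1) v

/-- The constant-term matrix `M(0)` of a link. [this file] -/
def constMat (L : W2Link m) : Matrix (Fin 2) (Fin 2) ℂ := L.M.map fun p => p.coeff 0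

/-- The skeleton vector `M_1(0) ⋯ M_N(0) · v` of a chain. [this file] -/
def skel (t : List (W2Link m)) (v : Fin 2 → ℂ) : Fin 2 → ℂ := ((t.map constMat).prod).mulVec v

/-- The row `uᵀM` against a basis vector is a row of `M`. [this file] -/
theorem rowPoly_single (M : Matrix (Fin 2) (Fin 2) ℂ[X]) (k j : Fin 2) : rowPoly M (Pi.single k 1) j = M k j := by
  rw [rowPoly, Fintype.sum_eq_single k fun i hi => by rw [Pi.single_eq_of_ne hi, Polynomial.C_0, zero_mul],
    Pi.single_eq_same, Polynomial.C_1, one_mul]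

/-- The empty chain: `G_k = v_k`. [this file] -/
theorem col_nil (v : Fin 2 → ℂ) (k : Fin 2) : col ([] : List (W2Link m)) v k = C (v k) := by
  rw [col, List.map_nil, chainVal_single, List.prod_nil, Matrix.one_mulVec]

/-- Peeling the head link: `G_k = M_{k0}(z_c)·G'_0 + M_{k1}(z_c)·G'_1`. [this file] -/
theorem col_cons (L : W2Link m) (rest : List (W2Link m)) (v : Fin 2 → ℂ) (k : Fin 2) :
    col (L :: rest) v k = uni L.blk (L.M k 0) * col rest v 0 + uni L.blk (L.M k 1) * col rest v 1 := by
  rw [col, chainVal_cons_mat, rowPoly_single, rowPoly_single]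
  rfl

/-- The same under `φ`. [this file] -/
theorem bind₁_col_cons (L : W2Link m) (rest : List (W2Link m)) (v : Fin 2 → ℂ) (k : Fin 2) :
    bind₁ (kiPer m) (col (L :: rest) v k) =
      Polynomial.aeval (kiPer m L.blk) (L.M k 0) * bind₁ (kiPer m) (col rest v 0) +
        Polynomial.aeval (kiPer m L.blk) (L.M k 1) * bind₁ (kiPer m) (col rest v 1) := by
  rw [col_cons, map_add, map_mul, map_mul, bind₁_uni, bind₁_uni]

/-- The chain value is `u_0·G_0 + u_1·G_1`. [this file] -/
theorem chainVal_eq_col (l : List (W2Link m)) (u v : Fin 2 → ℂ) :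
    chainVal (l.map W2Link.mat) u v = C (u 0) * col l v 0 + C (u 1) * col l v 1 :=
  chainVal_eq_lin _ u v

/-- The columns vanish for `v = 0`. [this file] -/
theorem col_zero (l : List (W2Link m)) (k : Fin 2) : col l 0 k = 0 := by
  have h : (fun j : Fin 2 => C ((0 : Fin 2 → ℂ) j)) = (0 : Fin 2 → MvPolynomial (Fin 3 → Fin (qOf m)) ℂ) :=
    funext fun j => by rw [Pi.zero_apply, C_0, Pi.zero_apply]
  rw [col, chainVal_single, h, Matrix.mulVec_zero, Pi.zero_apply]

/-- The empty skeleton vector is `v`. [this file] -/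
theorem skel_nil (v : Fin 2 → ℂ) : skel ([] : List (W2Link m)) v = v := by
  rw [skel, List.map_nil, List.prod_nil, Matrix.one_mulVec]

/-- Peeling the head of a skeleton vector. [this file] -/
theorem skel_cons (L : W2Link m) (rest : List (W2Link m)) (v : Fin 2 → ℂ) :
    skel (L :: rest) v = (constMat L).mulVec (skel rest v) := by
  rw [skel, skel, List.map_cons, List.prod_cons, Matrix.mulVec_mulVec]

/-- **The constant term of a column is the skeleton vector**: `G_k(0) = (M_1(0)⋯M_N(0)·v)_k`. [this file] -/
theorem constantCoeff_col (l : List (W2Link m)) (v : Fin 2 → ℂ) (k : Fin 2) :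
    constantCoeff (col l v k) = skel l v k := by
  induction l generalizing k with
  | nil => rw [col_nil, constantCoeff_C, skel_nil]
  | cons L rest ih =>
    rw [col_cons, map_add, map_mul, map_mul, constantCoeff_uni, constantCoeff_uni, ih, ih, skel_cons]
    simp [Matrix.mulVec, constMat]

/-- A block not read by the chain is not a variable of its columns. [this file] -/
theorem not_mem_vars_col {c : Fin 3 → Fin (qOf m)} {rest : List (W2Link m)} (hc : c ∉ rest.map W2Link.blk)
    (v : Fin 2 → ℂ) (k : Fin 2) : c ∉ (col rest v k).vars :=
  not_mem_vars_chainVal hc _ _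

/-- The determinant of the constant-term matrix is the constant term of the determinant. [this file] -/
theorem det_constMat (L : W2Link m) : (constMat L).det = L.M.det.coeff 0 := by
  rw [Polynomial.coeff_zero_eq_eval_zero, ← Polynomial.coe_evalRingHom, RingHom.map_det, RingHom.mapMatrix_apply]
  congr 1
  ext i j
  simp [constMat, Polynomial.coeff_zero_eq_eval_zero]

/-- Invertible constant-term matrices never kill a nonzero vector along the skeleton. [this file] -/
theorem skel_ne_zero {t : List (W2Link m)} (h0 : ∀ L ∈ t, (constMat L).det ≠ 0) {v : Fin 2 → ℂ} (hv : v ≠ 0) :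
    skel t v ≠ 0 := by
  induction t with
  | nil => rwa [skel_nil]
  | cons L t ih =>
    rw [skel_cons]
    exact fun h => ih (fun L' hL' => h0 L' (List.mem_cons_of_mem _ hL'))
      (Matrix.eq_zero_of_mulVec_eq_zero (h0 L List.mem_cons_self) h)

/-! ## 2. The axis substitution on columns -/

/-- `ψ_c` fixes the constants. [this file] -/
theorem axisHom_C (c : Fin 3 → Fin (qOf m)) (i₀ : Fin m) (a : ℂ) : axisHom m c i₀ (C a) = Polynomial.C a := by
  rw [← MvPolynomial.algebraMap_eq, AlgHom.commutes, Polynomial.algebraMap_eq]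

/-- `ψ_c(p(P_c)) = p`. [this file] -/
theorem axisHom_aeval_kiPer (c : Fin 3 → Fin (qOf m)) (i₀ : Fin m) (p : ℂ[X]) :
    axisHom m c i₀ (Polynomial.aeval (kiPer m c) p) = p := by
  rw [← Polynomial.aeval_algHom_apply, axisHom_kiPer_self, Polynomial.aeval_X_left_apply]

/-- **`ψ_c(φ G'_k) = ` the skeleton vector** for a suffix not reading `z_c` (`m ≥ 3`). [this file] -/
theorem axisHom_bind₁_col (hm : 3 ≤ m) {c : Fin 3 → Fin (qOf m)} {rest : List (W2Link m)}
    (hc : c ∉ rest.map W2Link.blk) (i₀ : Fin m) (v : Fin 2 → ℂ) (k : Fin 2) :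
    axisHom m c i₀ (bind₁ (kiPer m) (col rest v k)) = Polynomial.C (skel rest v k) := by
  rw [axisHom_bind₁_of_not_mem_vars hm c i₀ (not_mem_vars_col hc v k), constantCoeff_col]

/-! ## 3. The step: direction is inherited by the suffix -/

/-- Two parallel pairs over a nonzero constant direction differ by a scalar. [this file] -/
theorem exists_scalar_of_cross {σ : Type*} (Φ : Fin 2 → MvPolynomial σ ℂ) (g : Fin 2 → ℂ) (hg : g ≠ 0)
    (h : Φ 0 * C (g 1) = Φ 1 * C (g 0)) : ∃ x : MvPolynomial σ ℂ, ∀ j, Φ j = x * C (g j) := by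
  by_cases h0 : g 0 ≠ 0
  · have hi : C (g 0)⁻¹ * C (g 0) = (1 : MvPolynomial σ ℂ) := by rw [← C_mul, inv_mul_cancel₀ h0, C_1]
    refine ⟨Φ 0 * C (g 0)⁻¹, Fin.forall_fin_two.2 ⟨?_, ?_⟩⟩
    · rw [mul_assoc, hi, mul_one]
    · linear_combination (-C (g 0)⁻¹) * h - (Φ 1) * hi
  · have h0' : g 0 = 0 := not_not.1 h0
    have h1 : g 1 ≠ 0 := fun h1 => hg (funext (Fin.forall_fin_two.2 ⟨h0', h1⟩))
    have hi : C (g 1)⁻¹ * C (g 1) = (1 : MvPolynomial σ ℂ) := by rw [← C_mul, inv_mul_cancel₀ h1, C_1]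
    refine ⟨Φ 1 * C (g 1)⁻¹, Fin.forall_fin_two.2 ⟨?_, ?_⟩⟩
    · rw [h0', C_0, mul_zero] at h ⊢
      linear_combination C (g 1)⁻¹ * h - (Φ 0) * hi
    · rw [mul_assoc, hi, mul_one]

/-- The two `2 × 2` adjugate identities (`adj M · (M·Φ) = det M · Φ`), in SCALAR (entrywise) form on purpose: `step`
applies them to the images of the link entries under `Polynomial.aeval (kiPer m c)` inside an `MvPolynomial` ring, where
no `Matrix` object is formed; `Matrix.adjugate_fin_two` + `Matrix.adjugate_mul` would give the same two identities only
after `mulVec` bookkeeping, longer than the two `linear_combination` lines. [folklore; cf. Mathlib `Matrix.adjugate_fin_two`] -/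
theorem adjugate_two {A : Type*} [CommRing A] (a₀₀ a₀₁ a₁₀ a₁₁ Φ₀ Φ₁ x w₀ w₁ : A)
    (h0 : a₀₀ * Φ₀ + a₀₁ * Φ₁ = x * w₀) (h1 : a₁₀ * Φ₀ + a₁₁ * Φ₁ = x * w₁) :
    (a₀₀ * a₁₁ - a₀₁ * a₁₀) * Φ₀ = x * (a₁₁ * w₀ - a₀₁ * w₁) ∧
      (a₀₀ * a₁₁ - a₀₁ * a₁₀) * Φ₁ = x * (a₀₀ * w₁ - a₁₀ * w₀) :=
  ⟨by linear_combination a₁₁ * h0 - a₀₁ * h1, by linear_combination a₀₀ * h1 - a₁₀ * h0⟩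

/-- **THE STEP.** `M(P_c)·Φ = x·w` with `det M ≠ 0`, `ψ_c(Φ) = g ≠ 0` constant: then (a) `Φ = x'·g` for a polynomial
`x'`, and (b) `M(X)·g = ψ_c(x)·w` in `ℂ[X]²`. [this file] -/
theorem step (hm : 1 ≤ m) (c : Fin 3 → Fin (qOf m)) (i₀ : Fin m) (M : Matrix (Fin 2) (Fin 2) ℂ[X]) (hM : M.det ≠ 0)
    (w g : Fin 2 → ℂ) (hg : g ≠ 0) (x : MvPolynomial (Fin (qOf m) × Fin (qOf m)) ℂ)
    (Φ : Fin 2 → MvPolynomial (Fin (qOf m) × Fin (qOf m)) ℂ) (hψ : ∀ j, axisHom m c i₀ (Φ j) = Polynomial.C (g j))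
    (H : ∀ k, Polynomial.aeval (kiPer m c) (M k 0) * Φ 0 + Polynomial.aeval (kiPer m c) (M k 1) * Φ 1 = x * C (w k)) :
    (∃ x' : MvPolynomial (Fin (qOf m) × Fin (qOf m)) ℂ, ∀ j, Φ j = x' * C (g j)) ∧
      ∀ k, M k 0 * Polynomial.C (g 0) + M k 1 * Polynomial.C (g 1) = axisHom m c i₀ x * Polynomial.C (w k) := by
  have hb : ∀ k, M k 0 * Polynomial.C (g 0) + M k 1 * Polynomial.C (g 1) = axisHom m c i₀ x * Polynomial.C (w k) :=
    fun k => by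
    have h := congrArg (axisHom m c i₀) (H k)
    rwa [map_add, map_mul, map_mul, axisHom_aeval_kiPer, axisHom_aeval_kiPer, hψ 0, hψ 1, map_mul, axisHom_C] at h
  refine ⟨?_, hb⟩
  have hPC : ∀ a : ℂ, Polynomial.aeval (kiPer m c) (Polynomial.C a) = C a := fun a => by
    rw [Polynomial.aeval_C, MvPolynomial.algebraMap_eq]
  set a₀₀ := Polynomial.aeval (kiPer m c) (M 0 0) with ha₀₀
  set a₀₁ := Polynomial.aeval (kiPer m c) (M 0 1) with ha₀₁
  set a₁₀ := Polynomial.aeval (kiPer m c) (M 1 0) with ha₁₀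
  set a₁₁ := Polynomial.aeval (kiPer m c) (M 1 1) with ha₁₁
  set ξ := Polynomial.aeval (kiPer m c) (axisHom m c i₀ x) with hξ
  have hb' : ∀ k, Polynomial.aeval (kiPer m c) (M k 0) * C (g 0) + Polynomial.aeval (kiPer m c) (M k 1) * C (g 1) =
      ξ * C (w k) := fun k => by
    have h := congrArg (Polynomial.aeval (kiPer m c)) (hb k)
    rwa [map_add, map_mul, map_mul, map_mul, hPC, hPC, hPC] at h
  obtain ⟨e0, e1⟩ := adjugate_two a₀₀ a₀₁ a₁₀ a₁₁ (Φ 0) (Φ 1) x (C (w 0)) (C (w 1)) (H 0) (H 1)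
  obtain ⟨f0, f1⟩ := adjugate_two a₀₀ a₀₁ a₁₀ a₁₁ (C (g 0)) (C (g 1)) ξ (C (w 0)) (C (w 1)) (hb' 0) (hb' 1)
  have hδ : a₀₀ * a₁₁ - a₀₁ * a₁₀ ≠ 0 := by
    have h : a₀₀ * a₁₁ - a₀₁ * a₁₀ = Polynomial.aeval (kiPer m c) M.det := by
      rw [Matrix.det_fin_two, map_sub, map_mul, map_mul]
    rw [h]
    exact aeval_kiPer_ne_zero hm c hM
  have hcross : Φ 0 * C (g 1) = Φ 1 * C (g 0) := by
    refine mul_left_cancel₀ (pow_ne_zero 2 hδ) ?_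
    linear_combination ((a₀₀ * a₁₁ - a₀₁ * a₁₀) * C (g 1)) * e0 + (x * (a₁₁ * C (w 0) - a₀₁ * C (w 1))) * f1 -
      ((a₀₀ * a₁₁ - a₀₁ * a₁₀) * C (g 0)) * e1 - (x * (a₀₀ * C (w 1) - a₁₀ * C (w 0))) * f0
  exact exists_scalar_of_cross Φ g hg hcross

/-! ## 4. Direction rigidity and hitting -/

/-- **DIRECTION RIGIDITY** (`m ≥ 3`): nonsingular links, no vanishing proper-suffix skeleton vector, and a `φ`-image
column of constant direction `w ≠ 0` force the column itself to have direction `w`. [this file] -/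
theorem col_parallel (hm : 3 ≤ m) : ∀ (l : List (W2Link m)) (v w : Fin 2 → ℂ)
    (x : MvPolynomial (Fin (qOf m) × Fin (qOf m)) ℂ), (l.map W2Link.blk).Nodup → (∀ L ∈ l, L.M.det ≠ 0) →
    (∀ t : List (W2Link m), t <:+ l → t.length < l.length → skel t v ≠ 0) → w ≠ 0 →
    (∀ k, bind₁ (kiPer m) (col l v k) = x * C (w k)) →
    ∃ Xp : MvPolynomial (Fin 3 → Fin (qOf m)) ℂ, ∀ k, col l v k = Xp * C (w k) := by
  intro l
  induction l with
  | nil =>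
    intro v w x _ _ _ hw hx
    have h0 := hx 0
    have h1 := hx 1
    rw [col_nil, bind₁_C_right] at h0 h1
    have e : (C (v 0 * w 1) : MvPolynomial (Fin (qOf m) × Fin (qOf m)) ℂ) = C (v 1 * w 0) := by
      rw [C_mul, C_mul]
      linear_combination (C (w 1)) * h0 - (C (w 0)) * h1
    have e' : v 0 * w 1 = v 1 * w 0 := (C_injective _ _) e
    obtain ⟨Xp, hXp⟩ := exists_scalar_of_cross (σ := Fin 3 → Fin (qOf m)) (fun k => C (v k)) w hw
      (by
        show C (v 0) * C (w 1) = C (v 1) * C (w 0)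
        rw [← C_mul, ← C_mul, e'])
    exact ⟨Xp, fun k => by rw [col_nil]; exact hXp k⟩
  | cons L rest ih =>
    intro v w x hnd hdet hreg hw hx
    rw [List.map_cons, List.nodup_cons] at hnd
    have i₀ : Fin m := ⟨0, by omega⟩
    have hg : skel rest v ≠ 0 := hreg rest (List.suffix_cons L rest) (by simp)
    have hreg' : ∀ t : List (W2Link m), t <:+ rest → t.length < rest.length → skel t v ≠ 0 :=
      fun t ht hlt => hreg t (ht.trans (List.suffix_cons L rest)) (by rw [List.length_cons]; omega)
    have H : ∀ k, Polynomial.aeval (kiPer m L.blk) (L.M k 0) * bind₁ (kiPer m) (col rest v 0) +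
        Polynomial.aeval (kiPer m L.blk) (L.M k 1) * bind₁ (kiPer m) (col rest v 1) = x * C (w k) :=
      fun k => by rw [← bind₁_col_cons]; exact hx k
    obtain ⟨⟨x', hx'⟩, hb⟩ := step (by omega) L.blk i₀ L.M (hdet L List.mem_cons_self) w (skel rest v) hg x
      (fun j => bind₁ (kiPer m) (col rest v j)) (fun j => axisHom_bind₁_col hm hnd.1 i₀ v j) H
    obtain ⟨Xp', hXp'⟩ := ih v (skel rest v) x' hnd.2 (fun L' hL' => hdet L' (List.mem_cons_of_mem _ hL'))
      hreg' hg hx'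
    refine ⟨Xp' * uni L.blk (axisHom m L.blk i₀ x), fun k => ?_⟩
    have hbk := congrArg (uni L.blk) (hb k)
    rw [uni_add, uni_mul, uni_mul, uni_mul, uni_C, uni_C, uni_C] at hbk
    rw [col_cons, hXp' 0, hXp' 1]
    linear_combination Xp' * hbk

/-- **HITTING THE NO-STALL CLASS** (`m ≥ 3`): a width-2 read-once block chain (distinct blocks, any order and length,
arbitrary univariate links) with NONSINGULAR links whose proper-suffix skeleton vectors `M_{k+1}(0)⋯M_N(0)·v` are all
nonzero is not annihilated by `φ = bind₁ (kiPer m)` unless it is zero. [this file] -/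
theorem chainVal_eq_zero_of_skel (hm : 3 ≤ m) (l : List (W2Link m)) (hl : (l.map W2Link.blk).Nodup)
    (hdet : ∀ L ∈ l, L.M.det ≠ 0) (u v : Fin 2 → ℂ)
    (hreg : ∀ t : List (W2Link m), t <:+ l → t.length < l.length → skel t v ≠ 0)
    (h : bind₁ (kiPer m) (chainVal (l.map W2Link.mat) u v) = 0) : chainVal (l.map W2Link.mat) u v = 0 := by
  by_cases hu : u = 0
  · subst hu
    rw [chainVal_eq_col]
    simp
  · have hw : (![u 1, -u 0] : Fin 2 → ℂ) ≠ 0 := by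
      intro h0
      apply hu
      funext i
      fin_cases i
      · have h1 := congrFun h0 1
        simpa using h1
      · have h1 := congrFun h0 0
        simpa using h1
    rw [chainVal_eq_col, map_add, map_mul, map_mul, bind₁_C_right, bind₁_C_right] at h
    have hcross : (fun j => bind₁ (kiPer m) (col l v j)) 0 * C ((![u 1, -u 0] : Fin 2 → ℂ) 1) =
        (fun j => bind₁ (kiPer m) (col l v j)) 1 * C ((![u 1, -u 0] : Fin 2 → ℂ) 0) := by
      simp only [Matrix.cons_val_zero, Matrix.cons_val_one, map_neg]
      linear_combination -h
    obtain ⟨x, hx⟩ := exists_scalar_of_cross (fun j => bind₁ (kiPer m) (col l v j)) ![u 1, -u 0] hw hcross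
    obtain ⟨Xp, hXp⟩ := col_parallel hm l v ![u 1, -u 0] x hl hdet hreg hw hx
    rw [chainVal_eq_col, hXp 0, hXp 1]
    simp only [Matrix.cons_val_zero, Matrix.cons_val_one, map_neg]
    ring

/-- **EVERY WIDTH-2 READ-ONCE CHAIN WITH INVERTIBLE CONSTANT-TERM MATRICES IS HIT** (`m ≥ 3`; any boundary vectors,
order, length, degree). The `m = 2` counterexample of `DefinabilityGapWidthTwoAtTwo` (unipotent links) lies in this
class, so `m ≥ 3` is sharp. [this file] -/
theorem kiPer_hits_of_det_constMat_ne_zero (hm : 3 ≤ m) (l : List (W2Link m)) (hl : (l.map W2Link.blk).Nodup)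
    (h0 : ∀ L ∈ l, (constMat L).det ≠ 0) (u v : Fin 2 → ℂ) (hD : chainVal (l.map W2Link.mat) u v ≠ 0) :
    bind₁ (kiPer m) (chainVal (l.map W2Link.mat) u v) ≠ 0 := by
  intro h
  by_cases hv : v = 0
  · subst hv
    rw [chainVal_eq_col, col_zero, col_zero, mul_zero, mul_zero, add_zero] at hD
    exact hD rfl
  have hdet : ∀ L ∈ l, L.M.det ≠ 0 := fun L hL hd => h0 L hL (by rw [det_constMat, hd, Polynomial.coeff_zero])
  exact hD (chainVal_eq_zero_of_skel hm l hl hdet u v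
    (fun t ht _ => skel_ne_zero (fun L hL => h0 L (ht.subset hL)) hv) h)

/-- The same in the matrix-product currency of `IsROABP` (`w = 2`): links `M i` with entries `p(z_{π i})`, `π`
injective, all constant-term matrices invertible — then NO nonzero entry of `∏_i M i` is annihilated by `φ`. [this file] -/
theorem kiPer_hits_matrixProduct_of_constantCoeff (hm : 3 ≤ m) {N : ℕ} (π : Fin N → (Fin 3 → Fin (qOf m)))
    (hπ : Function.Injective π) (M : Fin N → Matrix (Fin 2) (Fin 2) (MvPolynomial (Fin 3 → Fin (qOf m)) ℂ))
    (hM : ∀ i a b, ∃ p : ℂ[X], M i a b = Polynomial.aeval (X (π i) : MvPolynomial (Fin 3 → Fin (qOf m)) ℂ) p)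
    (h0 : ∀ i, ((M i).map constantCoeff).det ≠ 0) (a b : Fin 2) (hD : (List.ofFn M).prod a b ≠ 0) :
    bind₁ (kiPer m) ((List.ofFn M).prod a b) ≠ 0 := by
  choose p hp using hM
  let lk : Fin N → W2Link m := fun i => ⟨π i, Matrix.of fun a b => p i a b⟩
  have hmat : ∀ i, (lk i).mat = M i := fun i => by
    refine Matrix.ext fun a b => ?_
    simp only [W2Link.mat, ulink, Matrix.map_apply, Matrix.of_apply, lk]
    exact (hp i a b).symm
  have hl : (List.ofFn lk).map W2Link.mat = List.ofFn M := by
    rw [List.map_ofFn]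
    exact congrArg List.ofFn (funext hmat)
  have hnd : ((List.ofFn lk).map W2Link.blk).Nodup := by
    rw [List.map_ofFn]
    exact List.nodup_ofFn_ofInjective hπ
  have hc0 : ∀ i, constMat (lk i) = (M i).map constantCoeff := fun i => by
    refine Matrix.ext fun a b => ?_
    simp only [constMat, Matrix.map_apply, Matrix.of_apply, lk, hp i a b]
    exact (constantCoeff_uni (π i) (p i a b)).symm
  have hval : (List.ofFn M).prod a b = chainVal ((List.ofFn lk).map W2Link.mat) (Pi.single a 1) (Pi.single b 1) := by
    rw [chainVal_single, hl]
    simp only [Matrix.mulVec, dotProduct]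
    rw [Fintype.sum_eq_single b fun j hj => by rw [Pi.single_eq_of_ne hj, C_0, mul_zero], Pi.single_eq_same, C_1,
      mul_one]
  rw [hval] at hD ⊢
  exact kiPer_hits_of_det_constMat_ne_zero hm _ hnd
    (fun L hL => by
      obtain ⟨i, rfl⟩ := List.mem_ofFn.1 hL
      rw [hc0]
      exact h0 i) _ _ hD

end Summit.ValiantsHypothesis.ValiantsHypothesis.Theorems.DefinabilityGapRegularSkeleton

end
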